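import Literature.NumberTheory.LFunctions.ZetaMulMeanValue
import Literature.NumberTheory.LFunctions.RealCharacterDivisorSums
import Mathlib.NumberTheory.ArithmeticFunction.Misc
import Mathlib.Analysis.SpecificLimits.Normed
import HarnessLib

/-!
# The sieve density of `ζ ⋆ χ` and its local factors

Topic `Literature/NumberTheory/LFunctions`. Everything in this file is PROVED.

For a quadratic character `χ ≠ 1` mod `q` the non-negative multiplicative function
`r = ζ ⋆ χ` (Mathlib `zetaMul`; real form `coeff χ`, `ZetaMulMeanValue.lean`) has the local values
`r(p^k) = ∑_{i ≤ k} χ(p)^i` and the "density of multiples of `p`" (Halberstam–Richert's `ω(p)/p`,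
Mathlib's `BoundingSieve.nu`)

  `ν(p) = (1 + χ(p)(1 − 1/p))/p`,   `1 − ν(p) = (1 − 1/p)(1 − χ(p)/p)`,

i.e. `ν(p) = (2p − 1)/p²`, `1/p`, `1/p²` according as `χ(p) = 1, 0, −1` — the residue of
`∑_{p ∣ n} r(n) n^{-s}` at `s = 1` divided by `L(1, χ)` (in the forthcoming
`Literature/NumberTheory/Sieve/ZetaMulSelbergSieve.lean` this is the `ν` of a Selberg sieve). The values of `χ` are taken through the tree's real arithmetic function
`DirichletAbel.reChar χ` (`RealCharacterPartialSums.lean`). This file provides: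

* the bridge `coeff_eq_charDivisorSum` between the tree's two real forms of `ζ ⋆ χ`
  (`ZetaMul.coeff`, `ZetaMulMeanValue.lean`, and `RealChar.charDivisorSum`,
  `RealCharacterDivisorSums.lean`), `coeff_eq_sum_divisors`, `coeff_prime_pow`, `convSum_eq` (the
  real forms of `r = ζ ⋆ χ` and of the hyperbola identity, in terms of `reChar χ`);
* `densAt χ p = ν(p)`, the multiplicative `dens χ = ∏_{p ∣ ·} ν(p)` (`ArithmeticFunction.prodPrimeFactors`),
  `0 < ν(p) < 1`, `one_sub_densAt`;
* **the local Selberg factors dominate the prime-power sums**: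
  `∑_{k=1}^{K} r(p^k)/p^k ≤ g(p) := ν(p)/(1 − ν(p))` for every prime `p` and every `K`
  (`sum_coeff_prime_pow_div_le`; Halberstam–Richert's `g(p) = ω(p)/(p − ω(p))`, Mathlib's
  `selbergTerms p`; the three cases are the geometric series
  `∑_{k≥1} (k+1)x^k = 1/(1−x)² − 1`, `∑_{j≥1} x^{2j} = x²/(1−x²)`, `∑_{k≥1} x^k = x/(1−x)` at `x = 1/p`),
  which is the hypothesis of the tree's `SelbergSieve.sum_le_selbergSum_of_multiplicative`
  (`Literature/NumberTheory/Sieve/SelbergSumLowerBound.lean`).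

These serve the tree's proof of Motohashi's theorem on the Brun–Titchmarsh constant and Siegel
zeros (`Literature/Barriers/Parity/BrunTitchmarshSiegelZero.lean`).

## References

* H. Halberstam, H.-E. Richert, *Sieve Methods*, Academic Press 1974, Ch. 3 §1 (the functions
  `ω(p)/p` — here `ν(p)` — and `g(p) = ω(p)/(p − ω(p)) = ν(p)/(1 − ν(p))`). [cite: HalberstamRichert1974, Ch. 3 §1]
* Y. Motohashi, *A note on Siegel's zeros*, Proc. Japan Acad. 55A (1979) 190–192 (the sequence
  `B(n) = ∑_{d ∣ n} χ(d) d^{-δ}` sifted there; here `δ = 0`). [cite: Motohashi1979SiegelZeros, proof of the Theorem]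
-/

noncomputable section

open Finset
open scoped ComplexOrder

namespace Literature.NumberTheory.LFunctions.ZetaMul

open DirichletAbel

variable {q : ℕ} (χ : DirichletCharacter ℂ q)

/-! ### `r = ζ ⋆ χ` and the hyperbola identity, real forms -/

/-- **Bridge between the tree's two real forms of `ζ ⋆ χ`**: `ZetaMul.coeff χ n` (the real part of
Mathlib's `zetaMul χ n`, `ZetaMulMeanValue.lean`) equals `RealChar.charDivisorSum χ n = ∑_{e ∣ n} reChar χ e`
(`RealCharacterDivisorSums.lean`), for every `χ` and `n`. [folklore] -/
theorem coeff_eq_charDivisorSum (n : ℕ) : coeff χ n = RealChar.charDivisorSum χ n := by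
  rw [RealChar.charDivisorSum_apply, coeff, DirichletCharacter.zetaMul,
    ArithmeticFunction.coe_zeta_mul_apply, Complex.re_sum]
  refine Finset.sum_congr rfl fun e he => ?_
  have he0 : e ≠ 0 := Nat.pos_iff_ne_zero.mp (Nat.pos_of_mem_divisors he)
  rw [reChar_apply χ he0]
  simp [toArithmeticFunction, he0]

/-- `r(n) = ∑_{e ∣ n} χ(e)` (real form, `χ(e) = reChar χ e`). [folklore] -/
theorem coeff_eq_sum_divisors (n : ℕ) : coeff χ n = ∑ e ∈ n.divisors, reChar χ e := by
  rw [coeff_eq_charDivisorSum, RealChar.charDivisorSum_apply]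

/-- `r(p^k) = ∑_{i=0}^{k} χ(p)^i` at a prime power (`RealChar.charDivisorSum_prime_pow` through the
bridge). [folklore] -/
theorem coeff_prime_pow (hq : χ ^ 2 = 1) {p : ℕ} (hp : p.Prime) (k : ℕ) :
    coeff χ (p ^ k) = ∑ i ∈ range (k + 1), reChar χ p ^ i := by
  rw [coeff_eq_charDivisorSum, RealChar.charDivisorSum_prime_pow χ hq hp]

/-- The hyperbola identity in real form: `∑_{n ≤ y} r(n) = ∑_{e ≤ y} χ(e) ⌊y/e⌋`. [cite: MontgomeryVaughan2007, §2.1 eq. (2.9)] -/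
theorem convSum_eq (hq : χ ^ 2 = 1) (y : ℕ) :
    convSum χ y = ∑ e ∈ Ioc 0 y, reChar χ e * ((y / e : ℕ) : ℝ) := by
  have h := sum_zetaMul_eq_sum_mul_div χ y
  rw [← ofReal_convSum χ hq] at h
  have h2 : (∑ e ∈ Ioc 0 y, reChar χ e * ((y / e : ℕ) : ℝ) : ℝ) =
      ((∑ d ∈ Ioc 0 y, χ (d : ZMod q) * ((y / d : ℕ) : ℂ)) : ℂ).re := by
    rw [Complex.re_sum]
    refine Finset.sum_congr rfl fun e he => ?_
    rw [← ofReal_reChar χ hq (Nat.pos_iff_ne_zero.mp (Finset.mem_Ioc.mp he).1)]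
    norm_cast
  rw [h2, ← h, Complex.ofReal_re]

/-! ### The sieve density `ν(p)` -/

/-- `ν(p) = (1 + χ(p)(1 − 1/p))/p` (Halberstam–Richert's `ω(p)/p`). [cite: HalberstamRichert1974, Ch. 3 §1] -/
def densAt (p : ℕ) : ℝ := (1 + reChar χ p * (1 - (p : ℝ)⁻¹)) * (p : ℝ)⁻¹

/-- `ν(d) = ∏_{p ∣ d} ν(p)` as a multiplicative arithmetic function. [folklore] -/
def dens : ArithmeticFunction ℝ := ArithmeticFunction.prodPrimeFactors (densAt χ)

/-- `dens` is multiplicative. [folklore] -/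
theorem isMultiplicative_dens : (dens χ).IsMultiplicative :=
  ArithmeticFunction.IsMultiplicative.prodPrimeFactors _

/-- `dens χ d = ∏_{p ∣ d} ν(p)` for `d ≠ 0`. [folklore] -/
theorem dens_apply {d : ℕ} (hd : d ≠ 0) : dens χ d = ∏ p ∈ d.primeFactors, densAt χ p :=
  ArithmeticFunction.prodPrimeFactors_apply hd

/-- `dens χ p = ν(p)` at a prime. [folklore] -/
theorem dens_apply_prime {p : ℕ} (hp : p.Prime) : dens χ p = densAt χ p := by
  rw [dens_apply χ hp.ne_zero, hp.primeFactors, Finset.prod_singleton]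

/-- `1 − ν(p) = (1 − 1/p)(1 − χ(p)/p)`. [cite: HalberstamRichert1974, Ch. 3 §1] -/
theorem one_sub_densAt (p : ℕ) :
    1 - densAt χ p = (1 - (p : ℝ)⁻¹) * (1 - reChar χ p * (p : ℝ)⁻¹) := by
  rw [densAt]; ring

/-- `0 < ν(p)` for every prime `p` (quadratic `χ`). [folklore] -/
theorem densAt_pos (hq : χ ^ 2 = 1) {p : ℕ} (hp : p.Prime) : 0 < densAt χ p := by
  have hp2 : (2 : ℝ) ≤ p := by exact_mod_cast hp.two_le
  have hx : 0 < (p : ℝ)⁻¹ := by positivity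
  have hx1 : (p : ℝ)⁻¹ ≤ 1 / 2 := by rw [inv_eq_one_div]; gcongr
  rw [densAt]
  refine mul_pos ?_ hx
  rcases reChar_trichotomy χ hq p with h | h | h <;> rw [h] <;> nlinarith

/-- `ν(p) < 1` for every prime `p` (quadratic `χ`). [folklore] -/
theorem densAt_lt_one (hq : χ ^ 2 = 1) {p : ℕ} (hp : p.Prime) : densAt χ p < 1 := by
  have hp2 : (2 : ℝ) ≤ p := by exact_mod_cast hp.two_le
  have hx : 0 < (p : ℝ)⁻¹ := by positivity
  have hx1 : (p : ℝ)⁻¹ ≤ 1 / 2 := by rw [inv_eq_one_div]; gcongr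
  rw [← sub_pos, one_sub_densAt]
  refine mul_pos (by linarith) ?_
  rcases reChar_trichotomy χ hq p with h | h | h <;> rw [h] <;> nlinarith

/-! ### The local Selberg factors dominate the prime-power sums -/

/-- `∑_{k=1}^{K} (k+1) x^k ≤ 1/(1−x)² − 1` for `0 ≤ x < 1`. [folklore] -/
theorem sum_Icc_succ_mul_pow_le {x : ℝ} (hx0 : 0 ≤ x) (hx1 : x < 1) (K : ℕ) :
    ∑ k ∈ Icc 1 K, ((k : ℝ) + 1) * x ^ k ≤ 1 / (1 - x) ^ 2 - 1 := by
  have h1 : HasSum (fun n : ℕ => (n : ℝ) * x ^ n) (x / (1 - x) ^ 2) :=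
    hasSum_coe_mul_geometric_of_norm_lt_one (by rwa [Real.norm_of_nonneg hx0])
  have h2 : HasSum (fun n : ℕ => x ^ n) (1 - x)⁻¹ := hasSum_geometric_of_lt_one hx0 hx1
  have h3 : HasSum (fun n : ℕ => ((n : ℝ) + 1) * x ^ n) (x / (1 - x) ^ 2 + (1 - x)⁻¹) := by
    convert h1.add h2 using 1
    funext n; ring
  have hval : x / (1 - x) ^ 2 + (1 - x)⁻¹ = 1 / (1 - x) ^ 2 := by
    have : (1 - x) ≠ 0 := by linarith
    field_simp
    ring
  rw [hval] at h3
  have h0 : (0 : ℕ) ∉ Icc 1 K := by simp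
  have hle := sum_le_hasSum (insert 0 (Icc 1 K)) (fun n _ => by positivity) h3
  rw [Finset.sum_insert h0] at hle
  simp only [Nat.cast_zero, zero_add, pow_zero, mul_one] at hle
  linarith

/-- `∑_{k=1}^{K} x^k ≤ 1/(1−x) − 1` for `0 ≤ x < 1`. [folklore] -/
theorem sum_Icc_pow_le {x : ℝ} (hx0 : 0 ≤ x) (hx1 : x < 1) (K : ℕ) :
    ∑ k ∈ Icc 1 K, x ^ k ≤ (1 - x)⁻¹ - 1 := by
  have h2 : HasSum (fun n : ℕ => x ^ n) (1 - x)⁻¹ := hasSum_geometric_of_lt_one hx0 hx1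
  have h0 : (0 : ℕ) ∉ Icc 1 K := by simp
  have hle := sum_le_hasSum (insert 0 (Icc 1 K)) (fun n _ => by positivity) h2
  rw [Finset.sum_insert h0, pow_zero] at hle
  linarith

/-- `∑_{k=1}^{K} [k even] x^k ≤ 1/(1−x²) − 1` for `0 ≤ x < 1` (substitute `k = 2j`). [folklore] -/
theorem sum_Icc_ite_even_pow_le {x : ℝ} (hx0 : 0 ≤ x) (hx1 : x < 1) (K : ℕ) :
    ∑ k ∈ Icc 1 K, (if Even k then x ^ k else 0) ≤ (1 - x ^ 2)⁻¹ - 1 := by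
  classical
  rw [← Finset.sum_filter]
  set E := (Icc 1 K).filter Even with hE
  have hterm : ∀ k ∈ E, x ^ k = (x ^ 2) ^ (k / 2) := by
    intro k hk
    rw [hE, Finset.mem_filter] at hk
    rw [← pow_mul, Nat.two_mul_div_two_of_even hk.2]
  rw [Finset.sum_congr rfl hterm]
  have hinj : Set.InjOn (fun k : ℕ => k / 2) E := by
    intro k hk k' hk' h
    simp only [hE, Finset.coe_filter, Set.mem_setOf_eq] at hk hk'
    have h1 := Nat.two_mul_div_two_of_even hk.2
    have h2 := Nat.two_mul_div_two_of_even hk'.2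
    simp only at h
    omega
  rw [← Finset.sum_image (f := fun j => (x ^ 2) ^ j) hinj]
  have hx2 : x ^ 2 < 1 := by nlinarith
  have h2 : HasSum (fun n : ℕ => (x ^ 2) ^ n) (1 - x ^ 2)⁻¹ :=
    hasSum_geometric_of_lt_one (by positivity) hx2
  have h0 : (0 : ℕ) ∉ E.image (fun k : ℕ => k / 2) := by
    rw [Finset.mem_image]
    rintro ⟨k, hk, hk0⟩
    rw [hE, Finset.mem_filter, Finset.mem_Icc] at hk
    have := Nat.two_mul_div_two_of_even hk.2
    omega
  have hle := sum_le_hasSum (insert 0 (E.image fun k : ℕ => k / 2)) (fun n _ => by positivity) h2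
  rw [Finset.sum_insert h0, pow_zero] at hle
  linarith

/-- **The local factors.** For quadratic `χ`, every prime `p` and every `K`:
`∑_{k=1}^{K} r(p^k)/p^k ≤ g(p) = ν(p)/(1 − ν(p))`. In the three cases `χ(p) = 1, 0, −1` the left side
is a partial sum of `∑ (k+1)p^{-k}`, `∑ p^{-k}`, `∑ p^{-2j}`, whose sums are exactly
`g(p) = (2p−1)/(p−1)², 1/(p−1), 1/(p²−1)`. [cite: HalberstamRichert1974, Ch. 3 §1] -/
theorem sum_coeff_prime_pow_div_le (hq : χ ^ 2 = 1) {p : ℕ} (hp : p.Prime) (K : ℕ) :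
    ∑ k ∈ Icc 1 K, coeff χ (p ^ k) / (p : ℝ) ^ k ≤ densAt χ p / (1 - densAt χ p) := by
  have hp2 : (2 : ℝ) ≤ p := by exact_mod_cast hp.two_le
  have hp0 : (0 : ℝ) < p := by linarith
  set x : ℝ := (p : ℝ)⁻¹ with hxdef
  have hx0 : 0 < x := by positivity
  have hx1 : x ≤ 1 / 2 := by rw [hxdef, inv_eq_one_div]; gcongr
  have hx1' : x < 1 := by linarith
  have hdiv : ∀ k : ℕ, coeff χ (p ^ k) / (p : ℝ) ^ k = coeff χ (p ^ k) * x ^ k := by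
    intro k; rw [hxdef, inv_pow, div_eq_mul_inv]
  simp_rw [hdiv, coeff_prime_pow χ hq hp]
  have hden : 1 - densAt χ p = (1 - x) * (1 - reChar χ p * x) := one_sub_densAt χ p
  have hnum : densAt χ p = (1 + reChar χ p * (1 - x)) * x := rfl
  rw [hden, hnum]
  have h1x : 0 < 1 - x := by linarith
  rcases reChar_trichotomy χ hq p with h | h | h <;> rw [h]
  · -- `χ(p) = 0`: `r(p^k) = 1`, geometric series
    have hterm : ∀ k ∈ Icc 1 K, (∑ i ∈ range (k + 1), (0 : ℝ) ^ i) * x ^ k = x ^ k := by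
      intro k _
      rw [Finset.sum_range_succ']
      simp
    rw [Finset.sum_congr rfl hterm]
    refine (sum_Icc_pow_le hx0.le hx1' K).trans (le_of_eq ?_)
    field_simp
    ring
  · -- `χ(p) = 1`: `r(p^k) = k + 1`
    have hterm : ∀ k ∈ Icc 1 K, (∑ i ∈ range (k + 1), (1 : ℝ) ^ i) * x ^ k =
        ((k : ℝ) + 1) * x ^ k := by
      intro k _; simp
    rw [Finset.sum_congr rfl hterm]
    refine (sum_Icc_succ_mul_pow_le hx0.le hx1' K).trans (le_of_eq ?_)
    have : (1 - x) ≠ 0 := h1x.ne'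
    field_simp
    ring
  · -- `χ(p) = −1`: `r(p^k) = [k even]`
    have hterm : ∀ k ∈ Icc 1 K, (∑ i ∈ range (k + 1), (-1 : ℝ) ^ i) * x ^ k =
        if Even k then x ^ k else 0 := by
      intro k _
      rw [neg_one_geom_sum]
      by_cases hk : Even k
      · rw [if_neg (by simpa [Nat.even_add_one] using hk), if_pos hk, one_mul]
      · rw [if_pos (by simpa [Nat.even_add_one] using hk), if_neg hk, zero_mul]
    rw [Finset.sum_congr rfl hterm]
    refine (sum_Icc_ite_even_pow_le hx0.le hx1' K).trans (le_of_eq ?_)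
    have hx2ne : 1 - x ^ 2 ≠ 0 := by nlinarith
    rw [show (1 : ℝ) + -1 * (1 - x) = x by ring, show (1 : ℝ) - -1 * x = 1 + x by ring,
      show (1 - x) * (1 + x) = 1 - x ^ 2 by ring, eq_div_iff hx2ne, sub_mul,
      inv_mul_cancel₀ hx2ne]
    ring

end Literature.NumberTheory.LFunctions.ZetaMul

end
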